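import Summits.QuantumFields.YangMills.Theorems.UnitScaleTiltProp7HolRatioPerStep
import Literature.MathematicalPhysics.QuantumFieldTheory.Balaban1983to89.LatticeWordStokes
import HarnessLib

/-!
# Route `UnitScaleTilt`, crux K1 «MinimiserStabilityRegPr» (stmt-QuantumFields-19200), route-R [RP] curved, the curved N6 row (R-C), transport geometry, Step C —
# TWO WORDS WITH THE SAME END GIVE THE SAME TRANSPORT UP TO `((|w₁| + |w₂|)²/4)·δ` (crude non-abelian Stokes in PERIMETER form), AND THE CONJUGATION LETTER
# `‖Ad_{U(w₁)}X − Ad_{U(w₂)}X‖ ≤ ((|w₁| + |w₂|)²/2)·δ·‖X‖`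

Cell `ym3-torus`, width seat `ym-ust-20520-w2` (g3).  Step C of the memo `RC-TRANSPORT-GEOMETRY-w2g3.md` (19200 evidence): the pure `LINE`-iterate `S_k` and the engine's
`A^{U₀}` transport each one-stroke term along two fine words from `embIter k c₋` with the same net displacement (nested centre combs vs corner `treeWord`), both of length
`O(d·L^k)`; at plaquette size `δ = ε·L^{−2k}` the perimeter form of ★p1's `LatticeWordStokes.dist1_holAt_le` gives a k-UNIFORM `O(d²ε)` — no area bookkeeping.  THEOREMS ONLY
(0 `def`, 0 `sorry`); `--supports stmt-QuantumFields-19200`, count-neutral.  YM₃ on T³ is a ladder rung (R3), not the Clay problem; nothing here claims the curved N6, S2, P, the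
crux or the gap.

WHAT IS PROVED (ns `…Theorems.Prop7TwoWordStokes`).
* §1 `walkEnd_eq_of_netDisp_eq`, ★ `dist1_holAt_inv_mul_holAt_le` — `netDisp w₁ = netDisp w₂ ⇒ dist1 (U(walk x w₂)⁻¹·U(walk x w₁)) ≤ ((|w₁|+|w₂|)²/4)·δ`
  (`PlaqSmall δ U`, `δ ≥ 0`; the closed word `wordRev w₂ ++ w₁` from the common end).
* §2 `norm_conj_sub_conj_le_dist1` — `‖h₁Xh₁* − h₂Xh₂*‖ ≤ 2·dist1(h₂⁻¹h₁)·‖X‖` for `SU(N)`; ★★ `norm_conj_holAt_sub_conj_holAt_le` — the title conjugation letter.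
HONEST SCOPE.  Generic letters; the instantiation (the explicit nested word of `S_k`, its length and net displacement) is the assembly's job.

References: T. Bałaban, CMP 98 (1985) 17–51 [Balaban1985Averaging] ((19)–(20) p.21, (9) p.19).
-/

noncomputable section

open scoped BigOperators Matrix.Norms.L2Operator

namespace Summit.QuantumFields.YangMills.Theorems.Prop7TwoWordStokes

open Literature.MathematicalPhysics.QuantumFieldTheory.Balaban1983to89
open T4Continuum T4ReflectionCone LatticeWordStokes
open Summit.QuantumFields.YangMills.Theorems.Prop7HolRatioPerStep (norm_coe_eq_one norm_star_coe_eq_one)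

variable {P : Params} {j : ℕ}

/-! ## §1 Two words, one end: the perimeter Stokes bound -/

/-- Words with the same net displacement from the same site end at the same site. [folklore] -/
theorem walkEnd_eq_of_netDisp_eq (x : Site P j) (w₁ w₂ : List (Letter P.d)) (h : ∀ ν, netDisp w₁ ν = netDisp w₂ ν) :
    walkEnd x w₁ = walkEnd x w₂ := by
  funext ν
  rw [walkEnd_apply, walkEnd_apply, h ν]

/-- ★ **TWO WORDS WITH THE SAME NET DISPLACEMENT GIVE TRANSPORTS WITHIN `((|w₁|+|w₂|)²/4)·δ`**: `dist1 (U(walk x w₂)⁻¹·U(walk x w₁)) ≤ ((|w₁| + |w₂|)²/4)·δ` under `PlaqSmall δ U`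
(the word `wordRev w₂ ++ w₁` from the common end is closed; ★p1's `dist1_holAt_le`). [cite: Balaban1985Averaging, (19)-(20) p.21] -/
theorem dist1_holAt_inv_mul_holAt_le {G : Type*} [GaugeGroup G] (U : GaugeField P j G) {δ : ℝ} (hδ : 0 ≤ δ) (hU : PlaqSmall δ U)
    (x : Site P j) (w₁ w₂ : List (Letter P.d)) (h : ∀ ν, netDisp w₁ ν = netDisp w₂ ν) :
    dist1 ((holAt U (walk x w₂))⁻¹ * holAt U (walk x w₁)) ≤ ((((w₁.length + w₂.length : ℕ) : ℝ)) ^ 2 / 4) * δ := by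
  -- the closed word `wordRev w₂ ++ w₁` from the common end
  have hclosed : ∀ ν, netDisp (wordRev w₂ ++ w₁) ν = 0 := fun ν => by rw [netDisp_append, netDisp_wordRev, h ν]; ring
  have hhol : holAt U (walk (walkEnd x w₂) (wordRev w₂ ++ w₁)) = (holAt U (walk x w₂))⁻¹ * holAt U (walk x w₁) := by
    rw [walk_append, holAt_append, holAt_walk_wordRev, walkEnd_walkEnd_wordRev]
  have hlen : ((wordRev w₂ ++ w₁).length : ℝ) = ((w₁.length + w₂.length : ℕ) : ℝ) := by
    rw [List.length_append, show (wordRev w₂).length = w₂.length by simp [wordRev]]; push_cast; ring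
  have hmain := dist1_holAt_le U hδ hU (wordRev w₂ ++ w₁) hclosed (walkEnd x w₂)
  rw [hhol, hlen] at hmain
  exact hmain

/-! ## §2 The conjugation letter -/

section SU

variable {n : Type*} [Fintype n] [DecidableEq n] [Nonempty n]

/-- `‖h₁Xh₁* − h₂Xh₂*‖ ≤ 2·dist1(h₂⁻¹h₁)·‖X‖` for `h₁, h₂ ∈ SU(N)` (`h₁Xh₁* − h₂Xh₂* = h₂(WXW* − X)h₂*`, `W = h₂⁻¹h₁`). [folklore] -/
theorem norm_conj_sub_conj_le_dist1 (h₁ h₂ : Matrix.specialUnitaryGroup n ℂ) (X : Matrix n n ℂ) :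
    ‖(h₁ : Matrix n n ℂ) * X * star (h₁ : Matrix n n ℂ) - (h₂ : Matrix n n ℂ) * X * star (h₂ : Matrix n n ℂ)‖
      ≤ 2 * dist1 (h₂⁻¹ * h₁) * ‖X‖ := by
  set W : Matrix.specialUnitaryGroup n ℂ := h₂⁻¹ * h₁ with hW
  have hWc : (W : Matrix n n ℂ) = star (h₂ : Matrix n n ℂ) * (h₁ : Matrix n n ℂ) := by
    rw [hW, Submonoid.coe_mul]; rfl
  have h22 : (h₂ : Matrix n n ℂ) * star (h₂ : Matrix n n ℂ) = 1 := Prop7HolRatioPerStep.coe_mul_star_self h₂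
  -- `h₁ = h₂·W`
  have h1W : (h₁ : Matrix n n ℂ) = (h₂ : Matrix n n ℂ) * (W : Matrix n n ℂ) := by
    rw [hWc, ← mul_assoc, h22, one_mul]
  have e : (h₁ : Matrix n n ℂ) * X * star (h₁ : Matrix n n ℂ) - (h₂ : Matrix n n ℂ) * X * star (h₂ : Matrix n n ℂ)
      = (h₂ : Matrix n n ℂ) * ((W : Matrix n n ℂ) * X * star (W : Matrix n n ℂ) - X) * star (h₂ : Matrix n n ℂ) := by
    rw [h1W, star_mul]; noncomm_ring
  rw [e]
  -- `‖WXW* − X‖ ≤ 2‖W − 1‖‖X‖`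
  have hin : ‖(W : Matrix n n ℂ) * X * star (W : Matrix n n ℂ) - X‖ ≤ 2 * ‖(W : Matrix n n ℂ) - 1‖ * ‖X‖ := by
    have e2 : (W : Matrix n n ℂ) * X * star (W : Matrix n n ℂ) - X = ((W : Matrix n n ℂ) - 1) * X * star (W : Matrix n n ℂ) + X * (star (W : Matrix n n ℂ) - 1) := by
      noncomm_ring
    have hs : ‖star (W : Matrix n n ℂ) - 1‖ = ‖(W : Matrix n n ℂ) - 1‖ := by
      rw [show star (W : Matrix n n ℂ) - 1 = star ((W : Matrix n n ℂ) - 1) by rw [star_sub, star_one], norm_star]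
    rw [e2]
    calc _ ≤ ‖(W : Matrix n n ℂ) - 1‖ * ‖X‖ * ‖star (W : Matrix n n ℂ)‖ + ‖X‖ * ‖star (W : Matrix n n ℂ) - 1‖ :=
          (norm_add_le _ _).trans (add_le_add ((norm_mul_le _ _).trans (mul_le_mul_of_nonneg_right (norm_mul_le _ _) (norm_nonneg _))) (norm_mul_le _ _))
      _ = 2 * ‖(W : Matrix n n ℂ) - 1‖ * ‖X‖ := by rw [norm_star_coe_eq_one, hs]; ring
  calc _ ≤ ‖(h₂ : Matrix n n ℂ)‖ * ‖(W : Matrix n n ℂ) * X * star (W : Matrix n n ℂ) - X‖ * ‖star (h₂ : Matrix n n ℂ)‖ :=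
        (norm_mul_le _ _).trans (mul_le_mul_of_nonneg_right (norm_mul_le _ _) (norm_nonneg _))
    _ = ‖(W : Matrix n n ℂ) * X * star (W : Matrix n n ℂ) - X‖ := by rw [norm_coe_eq_one, norm_star_coe_eq_one, one_mul, mul_one]
    _ ≤ 2 * ‖(W : Matrix n n ℂ) - 1‖ * ‖X‖ := hin
    _ = 2 * dist1 W * ‖X‖ := by rw [← FederbushMean.dist1_SU_eq]

/-- ★★ **THE CONJUGATION LETTER OF STEP C**: two fine words with the same net displacement transport any `X` to within `((|w₁|+|w₂|)²/2)·δ·‖X‖` of each other under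
`PlaqSmall δ U`: `‖U(w₁)XU(w₁)* − U(w₂)XU(w₂)*‖ ≤ ((|w₁|+|w₂|)²/2)·δ·‖X‖`. [cite: Balaban1985Averaging, (19)-(20) p.21] -/
theorem norm_conj_holAt_sub_conj_holAt_le (U : GaugeField P j (Matrix.specialUnitaryGroup n ℂ)) {δ : ℝ} (hδ : 0 ≤ δ) (hU : PlaqSmall δ U)
    (x : Site P j) (w₁ w₂ : List (Letter P.d)) (h : ∀ ν, netDisp w₁ ν = netDisp w₂ ν) (X : Matrix n n ℂ) :
    ‖((holAt U (walk x w₁) : Matrix.specialUnitaryGroup n ℂ) : Matrix n n ℂ) * X * star ((holAt U (walk x w₁) : Matrix.specialUnitaryGroup n ℂ) : Matrix n n ℂ)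
        - ((holAt U (walk x w₂) : Matrix.specialUnitaryGroup n ℂ) : Matrix n n ℂ) * X * star ((holAt U (walk x w₂) : Matrix.specialUnitaryGroup n ℂ) : Matrix n n ℂ)‖
      ≤ ((((w₁.length + w₂.length : ℕ) : ℝ)) ^ 2 / 2) * δ * ‖X‖ := by
  have h1 := norm_conj_sub_conj_le_dist1 (holAt U (walk x w₁)) (holAt U (walk x w₂)) X
  have h2 := dist1_holAt_inv_mul_holAt_le U hδ hU x w₁ w₂ h
  calc _ ≤ 2 * dist1 ((holAt U (walk x w₂))⁻¹ * holAt U (walk x w₁)) * ‖X‖ := h1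
    _ ≤ 2 * (((((w₁.length + w₂.length : ℕ) : ℝ)) ^ 2 / 4) * δ) * ‖X‖ :=
        mul_le_mul_of_nonneg_right (mul_le_mul_of_nonneg_left h2 (by norm_num)) (norm_nonneg _)
    _ = _ := by ring

end SU

end Summit.QuantumFields.YangMills.Theorems.Prop7TwoWordStokes

end
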